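import Mathlib
import HarnessLib

/-!
# Cube roots modulo `p ≡ 1 (mod 3)`: the Adleman–Manders–Miller iteration

The cube-root analogue of the Tonelli–Shanks algorithm (Adleman–Manders–Miller 1977), as an
iteration on residues `< p` computed with `· % p` only, and its correctness in `ZMod p`.

Write `p - 1 = 3ᵏ·s` with `3 ∤ s`, let `t` be a cubic NON-residue (`t^{(p-1)/3} ≠ 1`) and `m ≠ 0` a
cubic residue (`m^{(p-1)/3} = 1`); put `ζ = t^{(p-1)/3}` (a primitive cube root of unity),
`β = 3 - s mod 3`, `α = (1 + sβ)/3`. The state is `(x, b, c, E)`, initially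
`(m^α, m^{sβ}, t^s, 3^{k-2})` (so `x³ = m·b`), and one round reads the "digit" `d = b^E` and puts

* `d = 1`: `(x, b, c³, E/3)`; `d = ζ`: `(x c², b c⁶, c³, E/3)`; otherwise `(x c, b c³, c³, E/3)`.

The invariant after `n` rounds (`amm_step`): `x³ = m b`, `b = g^B` with `s·3^{min(n+1,k)} ∣ B` for a
generator `g`, `c = t^{s·3ⁿ}`, `E = 3^{k-1}/3^{n+1}`; hence after `N ≥ k - 1` rounds `b = 1` and
`x³ = m` (`amm_correct`, stated for the loop written with natural-number arithmetic modulo `p`, the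
form a program computes). Also here: `exists_generator` (a generator of `(ZMod p)ˣ` as a field
element, from `IsCyclic (ZMod p)ˣ`). Theorem-only file, independent of `CubeRootsModP.lean`; the
step function enters as a hypothesis `hF`.

## References

* L. M. Adleman, K. L. Manders, G. L. Miller, *On taking roots in finite fields*, FOCS 1977, §2
  [AdlemanMandersMiller1977].
* H. Cohen, *A Course in Computational Algebraic Number Theory*, GTM 138, 1993, §1.5.1
  (Tonelli–Shanks) [Cohen1993].
-/

namespace Literature.NumberTheory.ModularRoots

variable {p : ℕ} [hp : Fact p.Prime]

/-- **A generator of `(ZMod p)ˣ` as a field element**: every non-zero residue is a power of `g`,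
and `gⁿ = 1 ↔ p - 1 ∣ n` (the multiplicative group of a finite field is cyclic). [folklore] -/
theorem exists_generator :
    ∃ g : ZMod p, (∀ u : ZMod p, u ≠ 0 → ∃ n : ℕ, g ^ n = u) ∧ ∀ n : ℕ, g ^ n = 1 ↔ p - 1 ∣ n := by
  obtain ⟨gu, hgu⟩ := IsCyclic.exists_monoid_generator (α := (ZMod p)ˣ)
  have hord : orderOf gu = p - 1 := by
    rw [orderOf_eq_card_of_forall_mem_powers hgu, Nat.card_eq_fintype_card, ZMod.card_units]
  refine ⟨(gu : ZMod p), fun u hu => ?_, fun n => ?_⟩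
  · obtain ⟨n, hn⟩ := (Submonoid.mem_powers_iff _ _).1 (hgu (Units.mk0 u hu))
    exact ⟨n, by rw [← Units.val_pow_eq_pow_val, hn, Units.val_mk0]⟩
  · rw [← Units.val_pow_eq_pow_val, Units.val_eq_one, ← orderOf_dvd_iff_pow_eq_one, hord]

/-- Residues below `p` are equal iff they are equal in `ZMod p`. [folklore] -/
theorem natCast_inj_of_lt {u v : ℕ} (hu : u < p) (hv : v < p) : ((u : ZMod p) = v ↔ u = v) := by
  rw [ZMod.natCast_eq_natCast_iff', Nat.mod_eq_of_lt hu, Nat.mod_eq_of_lt hv]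

/-- **One round of the Adleman–Manders–Miller iteration preserves the invariant.**
[cite: AdlemanMandersMiller1977, §2] -/
theorem amm_step {g : ZMod p} (hg1 : ∀ n : ℕ, g ^ n = 1 ↔ p - 1 ∣ n) {k s a t : ℕ} (hk : 1 ≤ k)
    (hps : p - 1 = 3 ^ k * s) (ha : ¬ 3 ∣ a) (ht : (t : ZMod p) = g ^ a) (m : ZMod p)
    (F : ℕ × ℕ × ℕ × ℕ → ℕ × ℕ × ℕ × ℕ)
    (hF : ∀ x b c E, F (x, b, c, E) =
      if b ^ E % p = 1 then (x, b, c ^ 3 % p, E / 3)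
      else if b ^ E % p = t ^ ((p - 1) / 3) % p then
        (x * (c ^ 2 % p) % p, b * (c ^ 6 % p) % p, c ^ 3 % p, E / 3)
      else (x * c % p, b * (c ^ 3 % p) % p, c ^ 3 % p, E / 3))
    (n : ℕ) (st : ℕ × ℕ × ℕ × ℕ)
    (hst : st.1 < p ∧ (st.1 : ZMod p) ^ 3 = m * st.2.1 ∧
      (∃ B, g ^ B = (st.2.1 : ZMod p) ∧ s * 3 ^ min (n + 1) k ∣ B) ∧
      (st.2.2.1 : ZMod p) = (t : ZMod p) ^ (s * 3 ^ n) ∧ st.2.2.2 = 3 ^ (k - 1) / 3 ^ (n + 1)) :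
    (F st).1 < p ∧ ((F st).1 : ZMod p) ^ 3 = m * (F st).2.1 ∧
      (∃ B, g ^ B = ((F st).2.1 : ZMod p) ∧ s * 3 ^ min (n + 2) k ∣ B) ∧
      ((F st).2.2.1 : ZMod p) = (t : ZMod p) ^ (s * 3 ^ (n + 1)) ∧
      (F st).2.2.2 = 3 ^ (k - 1) / 3 ^ (n + 2) := by
  obtain ⟨x, b, c, E⟩ := st
  obtain ⟨hx, h1, ⟨B, hB, hdvd⟩, hc, hE⟩ := hst
  simp only at hx h1 hB hc hE
  have hp2 : 2 ≤ p := hp.out.two_le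
  have hp0 : 0 < p := by omega
  have hp1 : (1 : ℕ) < p := by omega
  -- `T = (p - 1)/3`
  set T := s * 3 ^ (k - 1) with hT
  have hpT : p - 1 = 3 * T := by
    rw [hps, hT, show 3 ^ k = 3 ^ (k - 1 + 1) by rw [Nat.sub_add_cancel hk], pow_succ]; ring
  have hT0 : 0 < T := by omega
  have hTdiv : (p - 1) / 3 = T := by omega
  -- the generator
  have hg0 : g ≠ 0 := fun h => by
    have h' := (hg1 (p - 1)).2 dvd_rfl
    rw [h, zero_pow (by omega)] at h'
    exact zero_ne_one h'
  have hη1 : g ^ T ≠ 1 := fun h => by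
    have h' := Nat.le_of_dvd hT0 ((hg1 T).1 h)
    omega
  have hη2 : g ^ (2 * T) ≠ 1 := fun h => by
    have h' := Nat.le_of_dvd (by omega) ((hg1 (2 * T)).1 h)
    omega
  have hη12 : g ^ T ≠ g ^ (2 * T) := fun h => by
    have h' : g ^ T * (g ^ T - 1) = 0 := by
      rw [mul_sub, mul_one, ← pow_add, ← two_mul, ← h, sub_self]
    rcases mul_eq_zero.1 h' with h'' | h''
    · exact hg0 ((pow_eq_zero_iff (by omega)).1 h'')
    · exact hη1 (sub_eq_zero.1 h'')
  have hη3 : (g ^ T) ^ 3 = 1 := by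
    rw [← pow_mul, mul_comm, ← hpT]
    exact (hg1 _).2 dvd_rfl
  have hηmod : ∀ e, (g ^ T) ^ e = (g ^ T) ^ (e % 3) := fun e => by
    conv_lhs => rw [← Nat.div_add_mod e 3, pow_add, pow_mul, hη3, one_pow, one_mul]
  -- casts
  have castpow : ∀ u v : ℕ, ((u ^ v % p : ℕ) : ZMod p) = (u : ZMod p) ^ v := fun u v => by
    rw [ZMod.natCast_mod, Nat.cast_pow]
  have castmul : ∀ u v : ℕ, ((u * v % p : ℕ) : ZMod p) = (u : ZMod p) * v := fun u v => by
    rw [ZMod.natCast_mod, Nat.cast_mul]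
  have hζ : ((t ^ ((p - 1) / 3) % p : ℕ) : ZMod p) = (g ^ T) ^ (a % 3) := by
    rw [castpow, ht, ← pow_mul, hTdiv, mul_comm, pow_mul, hηmod]
  have hE' : E / 3 = 3 ^ (k - 1) / 3 ^ (n + 2) := by
    rw [hE, Nat.div_div_eq_div_mul, ← pow_succ]
  have hc' : ((c ^ 3 % p : ℕ) : ZMod p) = (t : ZMod p) ^ (s * 3 ^ (n + 1)) := by
    rw [castpow, hc, ← pow_mul, pow_succ, mul_assoc]
  have hdlt : b ^ E % p < p := Nat.mod_lt _ hp0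
  have hζlt : t ^ ((p - 1) / 3) % p < p := Nat.mod_lt _ hp0
  rw [hF]
  by_cases hkn : k ≤ n + 1
  · -- the digit expansion is exhausted: `b = 1`
    have hmin' : min (n + 2) k = k := min_eq_right (by omega)
    rw [min_eq_right hkn] at hdvd
    have hb1 : (b : ZMod p) = 1 := by
      rw [← hB]
      exact (hg1 B).2 (by rw [hps, mul_comm]; exact hdvd)
    have hd : b ^ E % p = 1 := by
      rw [← natCast_inj_of_lt hdlt hp1, castpow, hb1, one_pow, Nat.cast_one]
    rw [if_pos hd]
    exact ⟨hx, h1, ⟨B, hB, by rw [hmin']; exact hdvd⟩, hc', hE'⟩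
  · push Not at hkn
    have hmin' : min (n + 2) k = n + 2 := min_eq_left hkn
    rw [min_eq_left hkn.le] at hdvd
    obtain ⟨e, he⟩ := hdvd
    obtain ⟨K, hK⟩ : ∃ K, k = n + 2 + K := ⟨k - (n + 2), by omega⟩
    have hk1 : k - 1 = n + 1 + K := by omega
    have hEv : E = 3 ^ K := by
      rw [hE, hk1, pow_add, Nat.mul_div_cancel_left _ (pow_pos (by norm_num) _)]
    have hBE : B * E = T * e := by
      rw [he, hEv, hT, hk1, pow_add]; ring
    have hd : ((b ^ E % p : ℕ) : ZMod p) = (g ^ T) ^ (e % 3) := by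
      rw [castpow, ← hB, ← pow_mul, hBE, pow_mul, hηmod]
    have hcg : (c : ZMod p) = g ^ (a * (s * 3 ^ n)) := by rw [hc, ht, ← pow_mul]
    have ha12 : a % 3 = 1 ∨ a % 3 = 2 := by omega
    by_cases he0 : e % 3 = 0
    · have hd1 : b ^ E % p = 1 := by
        rw [← natCast_inj_of_lt hdlt hp1, hd, he0, pow_zero, Nat.cast_one]
      rw [if_pos hd1]
      refine ⟨hx, h1, ⟨B, hB, ?_⟩, hc', hE'⟩
      rw [hmin', he]
      obtain ⟨e', rfl⟩ := Nat.dvd_of_mod_eq_zero he0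
      exact ⟨e', by ring⟩
    · have hd1 : ¬ b ^ E % p = 1 := by
        rw [← natCast_inj_of_lt hdlt hp1, hd, Nat.cast_one]
        intro h
        have h12 : e % 3 = 1 ∨ e % 3 = 2 := by omega
        rcases h12 with h' | h'
        · rw [h', pow_one] at h; exact hη1 h
        · rw [h', ← pow_mul, mul_comm] at h; exact hη2 h
      rw [if_neg hd1]
      by_cases hea : e % 3 = a % 3
      · have hd2 : b ^ E % p = t ^ ((p - 1) / 3) % p := by
          rw [← natCast_inj_of_lt hdlt hζlt, hd, hζ, hea]
        rw [if_pos hd2]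
        refine ⟨Nat.mod_lt _ hp0, ?_, ⟨B + 6 * (a * (s * 3 ^ n)), ?_, ?_⟩, hc', hE'⟩
        · simp only
          rw [castmul, castpow, castmul, castpow]
          linear_combination (c : ZMod p) ^ 6 * h1
        · simp only
          rw [castmul, castpow, pow_add, hB, mul_comm 6 (a * (s * 3 ^ n)), pow_mul, ← hcg]
        · rw [hmin', he]
          have h3 : 3 ∣ e + 2 * a := by omega
          obtain ⟨f, hf⟩ := h3
          refine ⟨f, ?_⟩
          have h' : s * 3 ^ (n + 2) * f = s * 3 ^ (n + 1) * (e + 2 * a) := by rw [hf]; ring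
          rw [h']; ring
      · have hd2 : ¬ b ^ E % p = t ^ ((p - 1) / 3) % p := by
          rw [← natCast_inj_of_lt hdlt hζlt, hd, hζ]
          intro h
          have hc2 : (e % 3 = 1 ∧ a % 3 = 2) ∨ (e % 3 = 2 ∧ a % 3 = 1) := by omega
          rcases hc2 with ⟨h1', h2'⟩ | ⟨h1', h2'⟩
          · rw [h1', h2', pow_one, ← pow_mul, mul_comm] at h; exact hη12 h
          · rw [h1', h2', pow_one, ← pow_mul, mul_comm] at h; exact hη12 h.symm
        rw [if_neg hd2]
        refine ⟨Nat.mod_lt _ hp0, ?_, ⟨B + 3 * (a * (s * 3 ^ n)), ?_, ?_⟩, hc', hE'⟩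
        · simp only
          rw [castmul, castmul, castpow]
          linear_combination (c : ZMod p) ^ 3 * h1
        · simp only
          rw [castmul, castpow, pow_add, hB, mul_comm 3 (a * (s * 3 ^ n)), pow_mul, ← hcg]
        · rw [hmin', he]
          have h3 : 3 ∣ e + a := by omega
          obtain ⟨f, hf⟩ := h3
          refine ⟨f, ?_⟩
          have h' : s * 3 ^ (n + 2) * f = s * 3 ^ (n + 1) * (e + a) := by rw [hf]; ring
          rw [h']; ring

/-- **The invariant along the iteration** (induction on the number of rounds).
[cite: AdlemanMandersMiller1977, §2] -/
theorem amm_iterate {g : ZMod p} (hg1 : ∀ n : ℕ, g ^ n = 1 ↔ p - 1 ∣ n) {k s a t : ℕ} (hk : 1 ≤ k)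
    (hps : p - 1 = 3 ^ k * s) (ha : ¬ 3 ∣ a) (ht : (t : ZMod p) = g ^ a) (m : ZMod p)
    (F : ℕ × ℕ × ℕ × ℕ → ℕ × ℕ × ℕ × ℕ)
    (hF : ∀ x b c E, F (x, b, c, E) =
      if b ^ E % p = 1 then (x, b, c ^ 3 % p, E / 3)
      else if b ^ E % p = t ^ ((p - 1) / 3) % p then
        (x * (c ^ 2 % p) % p, b * (c ^ 6 % p) % p, c ^ 3 % p, E / 3)
      else (x * c % p, b * (c ^ 3 % p) % p, c ^ 3 % p, E / 3))
    (st₀ : ℕ × ℕ × ℕ × ℕ)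
    (h₀ : st₀.1 < p ∧ (st₀.1 : ZMod p) ^ 3 = m * st₀.2.1 ∧
      (∃ B, g ^ B = (st₀.2.1 : ZMod p) ∧ s * 3 ^ min 1 k ∣ B) ∧
      (st₀.2.2.1 : ZMod p) = (t : ZMod p) ^ (s * 3 ^ 0) ∧ st₀.2.2.2 = 3 ^ (k - 1) / 3 ^ 1) :
    ∀ n : ℕ, (F^[n] st₀).1 < p ∧ ((F^[n] st₀).1 : ZMod p) ^ 3 = m * (F^[n] st₀).2.1 ∧
      (∃ B, g ^ B = ((F^[n] st₀).2.1 : ZMod p) ∧ s * 3 ^ min (n + 1) k ∣ B) ∧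
      ((F^[n] st₀).2.2.1 : ZMod p) = (t : ZMod p) ^ (s * 3 ^ n) ∧
      (F^[n] st₀).2.2.2 = 3 ^ (k - 1) / 3 ^ (n + 1)
  | 0 => h₀
  | n + 1 => by
    rw [Function.iterate_succ_apply']
    exact amm_step hg1 hk hps ha ht m F hF n _ (amm_iterate hg1 hk hps ha ht m F hF st₀ h₀ n)

/-- **Correctness of the Adleman–Manders–Miller cube root.** For a prime `p` with
`p - 1 = 3ᵏ·s`, `k ≥ 1`, `3 ∤ s`, a cubic non-residue `t` and a non-zero cubic residue `m`
(Euler: `m^{(p-1)/3} = 1`), the first component `r` of the state after `N ≥ k - 1` rounds from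
`(m^α, m^{sβ}, t^s, (p-1)/(9s))`, `β = 3 - s mod 3`, `α = (1 + sβ)/3`, is a residue `< p` with
`r³ = m`. [cite: AdlemanMandersMiller1977, §2, Theorem 1] -/
theorem amm_correct {k s N t m : ℕ} (hs3 : ¬ 3 ∣ s) (hk : 1 ≤ k) (hps : p - 1 = 3 ^ k * s)
    (hkN : k ≤ N + 1) (ht0 : (t : ZMod p) ≠ 0) (ht : (t : ZMod p) ^ ((p - 1) / 3) ≠ 1)
    (hm0 : (m : ZMod p) ≠ 0)
    (hm : (m : ZMod p) ^ ((p - 1) / 3) = 1) (F : ℕ × ℕ × ℕ × ℕ → ℕ × ℕ × ℕ × ℕ)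
    (hF : ∀ x b c E, F (x, b, c, E) =
      if b ^ E % p = 1 then (x, b, c ^ 3 % p, E / 3)
      else if b ^ E % p = t ^ ((p - 1) / 3) % p then
        (x * (c ^ 2 % p) % p, b * (c ^ 6 % p) % p, c ^ 3 % p, E / 3)
      else (x * c % p, b * (c ^ 3 % p) % p, c ^ 3 % p, E / 3)) :
    (F^[N] (m ^ ((1 + s * (3 - s % 3)) / 3) % p, m ^ (s * (3 - s % 3)) % p, t ^ s % p,
        (p - 1) / (9 * s))).1 < p ∧
      (((F^[N] (m ^ ((1 + s * (3 - s % 3)) / 3) % p, m ^ (s * (3 - s % 3)) % p, t ^ s % p,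
        (p - 1) / (9 * s))).1 : ℕ) : ZMod p) ^ 3 = m := by
  have hp2 : 2 ≤ p := hp.out.two_le
  have hp0 : 0 < p := by omega
  set T := s * 3 ^ (k - 1) with hT
  have hpT : p - 1 = 3 * T := by
    rw [hps, hT, show 3 ^ k = 3 ^ (k - 1 + 1) by rw [Nat.sub_add_cancel hk], pow_succ]; ring
  have hT0 : 0 < T := by omega
  have hTdiv : (p - 1) / 3 = T := by omega
  have hs0 : 0 < s := Nat.pos_of_ne_zero fun h => by
    rw [h, zero_mul] at hT
    omega
  -- generator, discrete logarithms of `t` and `m`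
  obtain ⟨g, hgen, hg1⟩ := exists_generator (p := p)
  obtain ⟨a, ha⟩ := hgen _ ht0
  obtain ⟨cm, hcm⟩ := hgen _ hm0
  have ha3 : ¬ 3 ∣ a := by
    rintro ⟨a', rfl⟩
    apply ht
    rw [← ha, ← pow_mul, hTdiv, show 3 * a' * T = a' * (3 * T) by ring, ← hpT]
    exact (hg1 _).2 (dvd_mul_left _ _)
  have hcm3 : 3 ∣ cm := by
    rw [← hcm, ← pow_mul, hTdiv] at hm
    have h := (hg1 _).1 hm
    rw [hpT] at h
    exact Nat.dvd_of_mul_dvd_mul_right hT0 h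
  -- the exponent `α`
  have hs12 : s % 3 = 1 ∨ s % 3 = 2 := by omega
  have h3α : 3 ∣ 1 + s * (3 - s % 3) := by
    apply Nat.dvd_of_mod_eq_zero
    rcases hs12 with h | h <;> simp only [h] <;> omega
  -- the initial invariant
  have h₀ := amm_iterate hg1 hk hps ha3 ha.symm (m : ZMod p) F hF
    (m ^ ((1 + s * (3 - s % 3)) / 3) % p, m ^ (s * (3 - s % 3)) % p, t ^ s % p, (p - 1) / (9 * s))
    (by
      refine ⟨Nat.mod_lt _ hp0, ?_, ⟨cm * (s * (3 - s % 3)), ?_, ?_⟩, ?_, ?_⟩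
      · simp only
        rw [ZMod.natCast_mod, ZMod.natCast_mod, Nat.cast_pow, Nat.cast_pow, ← pow_mul,
          Nat.div_mul_cancel h3α, add_comm, pow_succ, mul_comm]
      · simp only
        rw [ZMod.natCast_mod, Nat.cast_pow, pow_mul, hcm]
      · rw [min_eq_left hk, pow_one]
        obtain ⟨c', rfl⟩ := hcm3
        exact ⟨c' * (3 - s % 3), by ring⟩
      · simp only
        rw [ZMod.natCast_mod, Nat.cast_pow, pow_zero, mul_one]
      · simp only
        rw [pow_one, hps, show 3 ^ k = 3 ^ (k - 1 + 1) by rw [Nat.sub_add_cancel hk], pow_succ,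
          show 3 ^ (k - 1) * 3 * s = 3 ^ (k - 1) * (3 * s) by ring,
          show 9 * s = 3 * (3 * s) by ring, Nat.mul_div_mul_right _ _ (by omega)])
    N
  obtain ⟨hx, h1, ⟨B, hB, hdvd⟩, -, -⟩ := h₀
  refine ⟨hx, ?_⟩
  rw [min_eq_right hkN] at hdvd
  have hb1 : g ^ B = 1 := (hg1 B).2 (by rw [hps, mul_comm]; exact hdvd)
  rw [h1, ← hB, hb1, mul_one]

end Literature.NumberTheory.ModularRoots
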